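import Summits.CriticalPhenomena.CardyFormulaZ2.Theorems.HalfPlaneMarkDensityLaw.Negative.RatioTemplate

/-!
# `HalfPlaneMarkDensityLaw` (crux stmt-CriticalPhenomena-5661), line `Sketch`:
# deterministic WINDOW ESTIMATES for an `n⁻²`-Lipschitz lattice density (pure real analysis; lead c4-0)

First half of the subsequential difference-quotient lemma of the line (companion file
`…DensitySubseq`).  Data: lattice densities `g n : ℤ → ℝ`, CDFs `P n : ℝ → ℝ`, a point `x`, a
half-width `δ₀`, a constant `C ≥ 0`, with

* exact telescoping on `[x−δ₀, x+δ₀]`: `Σ_{⌊yn⌋ < k ≤ ⌊y'n⌋} g n k = P n y' − P n y`;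
* the `n⁻²`-Lipschitz bound `|g n k' − g n k| ≤ C (k'−k)/n²` on `[⌊(x−δ₀)n⌋, ⌊(x+δ₀)n⌋]`
  (for the crux: `shiftLipschitz`, stub L of the line, from the half-plane two-arm point bound).

Results (no probability, no limits in `n` except the last two):
* `abs_rightWindow_sub_le` / `abs_leftWindow_sub_le` — for `0 ≤ t ≤ δ₀`, `n ≥ 1`,
  `|(P n (x+t) − P n x) − (M/n)·(n · g n ⌊xn⌋)| ≤ C (M/n)²` with `M = (⌊(x + t) * n⌋ - ⌊x * n⌋).toNat = ⌊(x+t)n⌋ − ⌊xn⌋`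
  (resp. the left window `(⌊(x−t)n⌋, ⌊xn⌋]`, `M = (⌊x * n⌋ - ⌊(x - t) * n⌋).toNat`), and `M/n → t`
  (`tendsto_rwin_div`, `tendsto_lwin_div`);
* `eventually_abs_pointMass_le` — for `[0,1]`-valued `P`, eventually `|n · g n ⌊xn⌋| ≤ 2/t + 2Ct`
  (the crux's sequence is BOUNDED, with no arm estimate beyond the Lipschitz constant);
  closed registered form `stub_pointMassBounded`;
* `tendsto_floor_sub_floor_div` — `(⌊x'n⌋ − ⌊xn⌋)/n → x' − x`.
-/

noncomputable section

namespace Summit.CriticalPhenomena.CardyFormulaZ2.Cruxes.HalfPlaneMarkDensityLaw.SketchLine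

open MeasureTheory Filter Set
open scoped Topology
open Summit.CriticalPhenomena.CardyFormulaZ2.Theorems.HalfPlaneMarkDensityLaw.Negative

namespace Density


/-! ### Finite-sum bookkeeping -/

/-- If `|a i − a₀| ≤ c · N` for all `i < N` (with `c ≥ 0`), then `|Σ_{i<N} a i − N · a₀| ≤ c · N²`.
[folklore] -/
theorem abs_sum_range_sub_mul_le {a : ℕ → ℝ} {a₀ c : ℝ} {N : ℕ} (hc : 0 ≤ c)
    (h : ∀ i < N, |a i - a₀| ≤ c * N) :
    |∑ i ∈ Finset.range N, a i - N * a₀| ≤ c * (N : ℝ) ^ 2 := by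
  have hrepr : ∑ i ∈ Finset.range N, a i - N * a₀ = ∑ i ∈ Finset.range N, (a i - a₀) := by
    rw [Finset.sum_sub_distrib, Finset.sum_const, Finset.card_range, nsmul_eq_mul]
  rw [hrepr]
  refine (Finset.abs_sum_le_sum_abs _ _).trans ?_
  have hterm : ∀ i ∈ Finset.range N, |a i - a₀| ≤ c * N := fun i hi ↦ h i (Finset.mem_range.1 hi)
  refine (Finset.sum_le_sum hterm).trans (le_of_eq ?_)
  rw [Finset.sum_const, Finset.card_range, nsmul_eq_mul]
  have := hc
  ring

/-! ### The deterministic window estimates -/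

section Window

variable {g : ℕ → ℤ → ℝ} {P : ℕ → ℝ → ℝ} {x δ₀ C : ℝ}

/-- The right window count `⌊(x+t)n⌋ − ⌊xn⌋` is a nonnegative integer. [folklore] -/
theorem rwin_cast {x t : ℝ} (ht : 0 ≤ t) (n : ℕ) : (((⌊(x + t) * n⌋ - ⌊x * n⌋).toNat : ℕ) : ℤ) = ⌊(x + t) * n⌋ - ⌊x * n⌋ := by
  rw [Int.toNat_of_nonneg]
  exact sub_nonneg.2 (Int.floor_le_floor (mul_le_mul_of_nonneg_right (by linarith) (Nat.cast_nonneg _)))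

/-- The left window count `⌊xn⌋ − ⌊(x−t)n⌋` is a nonnegative integer. [folklore] -/
theorem lwin_cast {x t : ℝ} (ht : 0 ≤ t) (n : ℕ) : (((⌊x * n⌋ - ⌊(x - t) * n⌋).toNat : ℕ) : ℤ) = ⌊x * n⌋ - ⌊(x - t) * n⌋ := by
  rw [Int.toNat_of_nonneg]
  exact sub_nonneg.2 (Int.floor_le_floor (mul_le_mul_of_nonneg_right (by linarith) (Nat.cast_nonneg _)))

/-- `(⌊(x + t) * n⌋ - ⌊x * n⌋).toNat / n → t`. [folklore] -/
theorem tendsto_rwin_div {x t : ℝ} (ht : 0 ≤ t) :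
    Tendsto (fun n : ℕ ↦ ((⌊(x + t) * n⌋ - ⌊x * n⌋).toNat : ℝ) / n) atTop (𝓝 t) := by
  refine (tendsto_floor_window_div (x := x) ht).congr fun n ↦ ?_
  have h : (((⌊(x + t) * n⌋ - ⌊x * n⌋ : ℤ) : ℝ)) = (((⌊(x + t) * n⌋ - ⌊x * n⌋).toNat : ℕ) : ℝ) := by
    exact_mod_cast (rwin_cast ht n).symm
  rw [h]

/-- `(⌊x * n⌋ - ⌊(x - t) * n⌋).toNat / n → t`. [folklore] -/
theorem tendsto_lwin_div {x t : ℝ} (ht : 0 ≤ t) :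
    Tendsto (fun n : ℕ ↦ ((⌊x * n⌋ - ⌊(x - t) * n⌋).toNat : ℝ) / n) atTop (𝓝 t) := by
  have h := tendsto_floor_window_div (x := x - t) (δ := t) ht
  simp only [sub_add_cancel] at h
  refine h.congr fun n ↦ ?_
  have h' : (((⌊x * n⌋ - ⌊(x - t) * n⌋ : ℤ) : ℝ)) = (((⌊x * n⌋ - ⌊(x - t) * n⌋).toNat : ℕ) : ℝ) := by
    exact_mod_cast (lwin_cast ht n).symm
  rw [h']

/-- **Right window estimate.** Under the `n⁻²`-Lipschitz bound on `[⌊(x−δ₀)n⌋, ⌊(x+δ₀)n⌋]` and exact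
telescoping, for `0 ≤ t ≤ δ₀` and `n ≥ 1`:
`|(P n (x+t) − P n x) − (M/n) · (n · g n ⌊xn⌋)| ≤ C (M/n)²`, `M = (⌊(x + t) * n⌋ - ⌊x * n⌋).toNat`. [folklore] -/
theorem abs_rightWindow_sub_le (hC : 0 ≤ C) (hδ₀ : 0 ≤ δ₀)
    (hwin : ∀ n : ℕ, ∀ y y' : ℝ, x - δ₀ ≤ y → y ≤ y' → y' ≤ x + δ₀ →
      ∑ i ∈ Finset.range (⌊y' * n⌋ - ⌊y * n⌋).toNat, g n (⌊y * n⌋ + 1 + i) = P n y' - P n y)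
    (hlip : ∀ n : ℕ, 1 ≤ n → ∀ k k' : ℤ, ⌊(x - δ₀) * n⌋ ≤ k → k ≤ k' → k' ≤ ⌊(x + δ₀) * n⌋ →
      |g n k' - g n k| ≤ C * (k' - k) / (n : ℝ) ^ 2)
    {t : ℝ} (ht : 0 ≤ t) (htδ : t ≤ δ₀) {n : ℕ} (hn : 1 ≤ n) :
    |(P n (x + t) - P n x) - ((⌊(x + t) * n⌋ - ⌊x * n⌋).toNat : ℝ) / n * ((n : ℝ) * g n ⌊x * n⌋)|
      ≤ C * (((⌊(x + t) * n⌋ - ⌊x * n⌋).toNat : ℝ) / n) ^ 2 := by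
  have hn' : (0 : ℝ) < n := by exact_mod_cast hn
  have hsum := hwin n x (x + t) (by linarith) (by linarith) (by linarith)
  have hMint := rwin_cast (x := x) ht n
  -- termwise Lipschitz bound against `g n ⌊xn⌋`
  have hE : |∑ i ∈ Finset.range ((⌊(x + t) * n⌋ - ⌊x * n⌋).toNat), g n (⌊x * n⌋ + 1 + i) - ((⌊(x + t) * n⌋ - ⌊x * n⌋).toNat : ℝ) * g n ⌊x * n⌋|
      ≤ C / (n : ℝ) ^ 2 * ((⌊(x + t) * n⌋ - ⌊x * n⌋).toNat : ℝ) ^ 2 := by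
    refine abs_sum_range_sub_mul_le (by positivity) fun i hi ↦ ?_
    have h1 : ((i : ℕ) : ℤ) + 1 ≤ (((⌊(x + t) * n⌋ - ⌊x * n⌋).toNat : ℕ) : ℤ) := by exact_mod_cast hi
    rw [hMint] at h1
    have hlo : ⌊(x - δ₀) * (n : ℝ)⌋ ≤ ⌊x * n⌋ :=
      Int.floor_le_floor (mul_le_mul_of_nonneg_right (by linarith) (Nat.cast_nonneg _))
    have hk2 : ⌊x * (n : ℝ)⌋ + 1 + i ≤ ⌊(x + δ₀) * n⌋ := by
      have h2 : ⌊(x + t) * (n : ℝ)⌋ ≤ ⌊(x + δ₀) * n⌋ :=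
        Int.floor_le_floor (mul_le_mul_of_nonneg_right (by linarith) (Nat.cast_nonneg _))
      omega
    have h := hlip n hn ⌊x * n⌋ (⌊x * n⌋ + 1 + i) hlo (by omega) hk2
    refine h.trans ?_
    have hi' : ((i : ℝ) + 1) ≤ ((⌊(x + t) * n⌋ - ⌊x * n⌋).toNat : ℝ) := by
      have : i + 1 ≤ (⌊(x + t) * n⌋ - ⌊x * n⌋).toNat := hi
      exact_mod_cast this
    push_cast
    rw [show C * ((⌊x * (n : ℝ)⌋ : ℝ) + 1 + i - ⌊x * (n : ℝ)⌋) / (n : ℝ) ^ 2 = C / (n : ℝ) ^ 2 * ((i : ℝ) + 1)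
      by ring]
    exact mul_le_mul_of_nonneg_left hi' (by positivity)
  rw [← hsum]
  have hkey : ∑ i ∈ Finset.range ((⌊(x + t) * n⌋ - ⌊x * n⌋).toNat), g n (⌊x * n⌋ + 1 + i)
        - ((⌊(x + t) * n⌋ - ⌊x * n⌋).toNat : ℝ) / n * ((n : ℝ) * g n ⌊x * n⌋)
      = ∑ i ∈ Finset.range ((⌊(x + t) * n⌋ - ⌊x * n⌋).toNat), g n (⌊x * n⌋ + 1 + i) - ((⌊(x + t) * n⌋ - ⌊x * n⌋).toNat : ℝ) * g n ⌊x * n⌋ := by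
    have hn'' := hn'.ne'
    field_simp
  rw [hkey]
  refine hE.trans (le_of_eq ?_)
  have hn'' := hn'.ne'
  field_simp

/-- **Left window estimate.** Under the same hypotheses, for `0 ≤ t ≤ δ₀` and `n ≥ 1`:
`|(P n x − P n (x−t)) − (M/n) · (n · g n ⌊xn⌋)| ≤ C (M/n)²`, `M = (⌊x * n⌋ - ⌊(x - t) * n⌋).toNat`. [folklore] -/
theorem abs_leftWindow_sub_le (hC : 0 ≤ C) (hδ₀ : 0 ≤ δ₀)
    (hwin : ∀ n : ℕ, ∀ y y' : ℝ, x - δ₀ ≤ y → y ≤ y' → y' ≤ x + δ₀ →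
      ∑ i ∈ Finset.range (⌊y' * n⌋ - ⌊y * n⌋).toNat, g n (⌊y * n⌋ + 1 + i) = P n y' - P n y)
    (hlip : ∀ n : ℕ, 1 ≤ n → ∀ k k' : ℤ, ⌊(x - δ₀) * n⌋ ≤ k → k ≤ k' → k' ≤ ⌊(x + δ₀) * n⌋ →
      |g n k' - g n k| ≤ C * (k' - k) / (n : ℝ) ^ 2)
    {t : ℝ} (ht : 0 ≤ t) (htδ : t ≤ δ₀) {n : ℕ} (hn : 1 ≤ n) :
    |(P n x - P n (x - t)) - ((⌊x * n⌋ - ⌊(x - t) * n⌋).toNat : ℝ) / n * ((n : ℝ) * g n ⌊x * n⌋)|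
      ≤ C * (((⌊x * n⌋ - ⌊(x - t) * n⌋).toNat : ℝ) / n) ^ 2 := by
  have hn' : (0 : ℝ) < n := by exact_mod_cast hn
  have hsum := hwin n (x - t) x (by linarith) (by linarith) (by linarith)
  have hMint := lwin_cast (x := x) ht n
  have hE : |∑ i ∈ Finset.range ((⌊x * n⌋ - ⌊(x - t) * n⌋).toNat), g n (⌊(x - t) * n⌋ + 1 + i)
        - ((⌊x * n⌋ - ⌊(x - t) * n⌋).toNat : ℝ) * g n ⌊x * n⌋| ≤ C / (n : ℝ) ^ 2 * ((⌊x * n⌋ - ⌊(x - t) * n⌋).toNat : ℝ) ^ 2 := by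
    refine abs_sum_range_sub_mul_le (by positivity) fun i hi ↦ ?_
    have h1 : ((i : ℕ) : ℤ) + 1 ≤ (((⌊x * n⌋ - ⌊(x - t) * n⌋).toNat : ℕ) : ℤ) := by exact_mod_cast hi
    rw [hMint] at h1
    have hlo : ⌊(x - δ₀) * (n : ℝ)⌋ ≤ ⌊(x - t) * n⌋ + 1 + i := by
      have : ⌊(x - δ₀) * (n : ℝ)⌋ ≤ ⌊(x - t) * n⌋ :=
        Int.floor_le_floor (mul_le_mul_of_nonneg_right (by linarith) (Nat.cast_nonneg _))
      omega
    have hhi : ⌊x * (n : ℝ)⌋ ≤ ⌊(x + δ₀) * n⌋ :=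
      Int.floor_le_floor (mul_le_mul_of_nonneg_right (by linarith) (Nat.cast_nonneg _))
    have h := hlip n hn (⌊(x - t) * n⌋ + 1 + i) ⌊x * n⌋ hlo (by omega) hhi
    rw [abs_sub_comm]
    refine h.trans ?_
    have hi' : (⌊x * (n : ℝ)⌋ : ℝ) - ((⌊(x - t) * (n : ℝ)⌋ : ℝ) + 1 + i) ≤ ((⌊x * n⌋ - ⌊(x - t) * n⌋).toNat : ℝ) := by
      have h3 : ⌊x * (n : ℝ)⌋ - (⌊(x - t) * (n : ℝ)⌋ + 1 + i) ≤ (((⌊x * n⌋ - ⌊(x - t) * n⌋).toNat : ℕ) : ℤ) := by omega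
      exact_mod_cast h3
    push_cast
    rw [show C * ((⌊x * (n : ℝ)⌋ : ℝ) - ((⌊(x - t) * (n : ℝ)⌋ : ℝ) + 1 + i)) / (n : ℝ) ^ 2
      = C / (n : ℝ) ^ 2 * ((⌊x * (n : ℝ)⌋ : ℝ) - ((⌊(x - t) * (n : ℝ)⌋ : ℝ) + 1 + i)) by ring]
    exact mul_le_mul_of_nonneg_left hi' (by positivity)
  rw [← hsum]
  have hkey : ∑ i ∈ Finset.range ((⌊x * n⌋ - ⌊(x - t) * n⌋).toNat), g n (⌊(x - t) * n⌋ + 1 + i)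
        - ((⌊x * n⌋ - ⌊(x - t) * n⌋).toNat : ℝ) / n * ((n : ℝ) * g n ⌊x * n⌋)
      = ∑ i ∈ Finset.range ((⌊x * n⌋ - ⌊(x - t) * n⌋).toNat), g n (⌊(x - t) * n⌋ + 1 + i)
        - ((⌊x * n⌋ - ⌊(x - t) * n⌋).toNat : ℝ) * g n ⌊x * n⌋ := by
    have hn'' := hn'.ne'
    field_simp
  rw [hkey]
  refine hE.trans (le_of_eq ?_)
  have hn'' := hn'.ne'
  field_simp

/-- **A priori bound on the full sequence.** If moreover `P` is `[0,1]`-valued, then for every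
`t ∈ (0, δ₀]` eventually `|n · g n ⌊xn⌋| ≤ 2/t + 2Ct`. [folklore] -/
theorem eventually_abs_pointMass_le (hC : 0 ≤ C) (hδ₀ : 0 ≤ δ₀)
    (hwin : ∀ n : ℕ, ∀ y y' : ℝ, x - δ₀ ≤ y → y ≤ y' → y' ≤ x + δ₀ →
      ∑ i ∈ Finset.range (⌊y' * n⌋ - ⌊y * n⌋).toNat, g n (⌊y * n⌋ + 1 + i) = P n y' - P n y)
    (hlip : ∀ n : ℕ, 1 ≤ n → ∀ k k' : ℤ, ⌊(x - δ₀) * n⌋ ≤ k → k ≤ k' → k' ≤ ⌊(x + δ₀) * n⌋ →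
      |g n k' - g n k| ≤ C * (k' - k) / (n : ℝ) ^ 2)
    (hP01 : ∀ n : ℕ, ∀ y : ℝ, P n y ∈ Icc (0 : ℝ) 1)
    {t : ℝ} (ht : 0 < t) (htδ : t ≤ δ₀) :
    ∀ᶠ n : ℕ in atTop, |(n : ℝ) * g n ⌊x * n⌋| ≤ 2 / t + 2 * C * t := by
  have hMpos : ∀ᶠ n : ℕ in atTop, t / 2 < ((⌊(x + t) * n⌋ - ⌊x * n⌋).toNat : ℝ) / n :=
    (tendsto_rwin_div (x := x) ht.le).eventually (lt_mem_nhds (by linarith))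
  have hMup : ∀ᶠ n : ℕ in atTop, ((⌊(x + t) * n⌋ - ⌊x * n⌋).toNat : ℝ) / n < 2 * t :=
    (tendsto_rwin_div (x := x) ht.le).eventually (gt_mem_nhds (by linarith))
  filter_upwards [hMpos, hMup, eventually_ge_atTop 1] with n hMp hMu hn
  have hest := abs_rightWindow_sub_le hC hδ₀ hwin hlip ht.le htδ hn
  set m : ℝ := ((⌊(x + t) * n⌋ - ⌊x * n⌋).toNat : ℝ) / n with hm
  set d : ℝ := (n : ℝ) * g n ⌊x * n⌋ with hd
  have hm0 : 0 < m := by linarith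
  have hΔ : |P n (x + t) - P n x| ≤ 1 := by
    have h1 := hP01 n (x + t)
    have h2 := hP01 n x
    rw [abs_le]; constructor <;> linarith [h1.1, h1.2, h2.1, h2.2]
  -- `|m d| ≤ 1 + C m²`, hence `|d| ≤ 1/m + C m ≤ 2/t + 2Ct`
  have h1 : |m * d| ≤ 1 + C * m ^ 2 := by
    have := abs_sub_abs_le_abs_sub (m * d) (P n (x + t) - P n x)
    rw [abs_sub_comm] at hest
    linarith
  rw [abs_mul, abs_of_pos hm0] at h1
  have h2 : |d| ≤ 1 / m + C * m := by
    rw [div_add' _ _ _ hm0.ne', le_div_iff₀ hm0]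
    nlinarith
  have h3 : 1 / m ≤ 2 / t := by
    rw [div_le_div_iff₀ hm0 ht]; linarith
  have h4 : C * m ≤ 2 * C * t := by nlinarith
  linarith

/-- **Registered extra stub of line `Sketch` (lead c4-0): the crux-type sequence is bounded**,
closed form of `eventually_abs_pointMass_le`. [folklore] -/
theorem stub_pointMassBounded :
    ∀ (g : ℕ → ℤ → ℝ) (P : ℕ → ℝ → ℝ) (x δ₀ C : ℝ), 0 ≤ C → 0 ≤ δ₀ →
      (∀ n : ℕ, ∀ y y' : ℝ, x - δ₀ ≤ y → y ≤ y' → y' ≤ x + δ₀ →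
        ∑ i ∈ Finset.range (⌊y' * n⌋ - ⌊y * n⌋).toNat, g n (⌊y * n⌋ + 1 + i) = P n y' - P n y) →
      (∀ n : ℕ, 1 ≤ n → ∀ k k' : ℤ, ⌊(x - δ₀) * n⌋ ≤ k → k ≤ k' → k' ≤ ⌊(x + δ₀) * n⌋ →
        |g n k' - g n k| ≤ C * (k' - k) / (n : ℝ) ^ 2) →
      (∀ n : ℕ, ∀ y : ℝ, P n y ∈ Icc (0 : ℝ) 1) →
      ∀ t : ℝ, 0 < t → t ≤ δ₀ → ∀ᶠ n : ℕ in atTop, |(n : ℝ) * g n ⌊x * n⌋| ≤ 2 / t + 2 * C * t :=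
  fun _ _ _ _ _ hC hδ₀ hwin hlip hP01 _ ht htδ ↦ eventually_abs_pointMass_le hC hδ₀ hwin hlip hP01 ht htδ

end Window

/-! ### A floor limit -/

/-- `(⌊x'n⌋ − ⌊xn⌋)/n → x' − x`. [folklore] -/
theorem tendsto_floor_sub_floor_div (x x' : ℝ) :
    Tendsto (fun n : ℕ ↦ ((⌊x' * n⌋ - ⌊x * n⌋ : ℤ) : ℝ) / n) atTop (𝓝 (x' - x)) := by
  rcases le_total x x' with h | h
  · have := tendsto_floor_window_div (x := x) (δ := x' - x) (sub_nonneg.2 h)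
    simpa only [add_sub_cancel] using this
  · have h1 := tendsto_floor_window_div (x := x') (δ := x - x') (sub_nonneg.2 h)
    simp only [add_sub_cancel] at h1
    have h2 := h1.neg
    rw [show -(x - x') = x' - x by ring] at h2
    refine h2.congr' (Eventually.of_forall fun n ↦ ?_)
    push_cast; ring

end Density

end Summit.CriticalPhenomena.CardyFormulaZ2.Cruxes.HalfPlaneMarkDensityLaw.SketchLine
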